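import Literature.MathematicalPhysics.QuantumLattice.SectorisedKernelNorm
import HarnessLib

/-!
# Prescribed-legs sector sums: the elementary bookkeeping (antitone in the prescribed set, the two extreme tracks, count × per-tuple size)

Topic `MathematicalPhysics/QuantumLattice`; generic layer (label set `P × S`), companion of `SectorisedKernelNorm` §1 and of
`SectorisedKernelNormRefinementPrescribed` (the re-sectorisation rule for the same sums).  For a kernel family `W_σ(X)` on `m + 1` legs, a
constraint set `A` of sector tuples, a set `E` of legs whose sectors are PRESCRIBED by `τ|_E`, and a position-pinned leg `p`, the prescribed sum is
`ε^m Σ_{σ ∈ A, σ|_E = τ|_E} Σ_{X : X_p = x} ‖W_σ(X)‖` (written out; no definition is introduced).  Benfatto–Giuliani–Mastropietro 2006 §2.8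
(2.88)–(2.90) and App. A3 Lemma A3.1: the sizes of the kernels are carried by the number of KNOWN external sectors — the more legs are known, the fewer
are summed — and a class of configurations is paid by (its sparsity at fixed prescription) × (the per-tuple size):

* `prescribedSum_antitone` — enlarging the prescribed set `E ⊆ E′` can only decrease the sum (the tracks are ANTITONE in the number of
  known legs);
* `prescribedSum_singleton_eq_sectorLegSum` — `E = {p}`: the anchored leg sum `legSum_A(W; p, τ_p, x)` of `SectorisedKernelNorm`;
* `prescribedSum_le_sectorLegSum` — every track with `p ∈ E` is bounded by the anchored leg sum (hence by the sectorised norm);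
* `prescribedSum_univ_eq` — `E = univ`: the pinned size of the single tuple `τ` (or `0` if `τ ∉ A`);
* `prescribedSum_le_card_mul` — (number of `σ ∈ A` with `σ|_E = τ|_E`) × (a bound on the per-tuple pinned sizes): the slot through which a
  SPARSE class of configurations (e.g. the umklapp-corner class of the lattice sector count) is paid by its cardinality at fixed prescription;
* `prescribedSum_add_le` / `prescribedSum_sum_le` — subadditivity in the kernel family (an effective action is the SUM of its increments born at
  the earlier levels; each is re-measured separately), and the Hubbard forms `sectorisedKernel_sum` (linearity in `G` over a finite sum) /
  `hubbardSectorPrescribedSum_sum_le`.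

Cell gate-hubbard-kl, K3 engine child, clause (E1): the LEVELS track of the blocked birth-level tower (E1-TOWER-BLOCKED §10: data antitone in
the track index; on-class row `K_B × b₂`).  Everything is proved; no definition, no named fact.

## Sources

G. Benfatto, A. Giuliani, V. Mastropietro, Ann. Henri Poincaré 7 (2006) 809–898, §2.8 (2.88)–(2.90), App. A3 Lemma A3.1
[`BenfattoGiulianiMastropietro2006`].
-/

noncomputable section

namespace Literature.MathematicalPhysics.QuantumLattice

open Finset

variable {𝕜 : Type*} [RCLike 𝕜] {S P : Type*} [DecidableEq S] [Fintype P] [DecidableEq P]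

/-- **The prescribed sums are antitone in the prescribed set**: if `E ⊆ E′` then
`ε^m Σ_{σ ∈ A, σ|_{E′} = τ|_{E′}} Σ_{X_p = x} ‖W_σ(X)‖ ≤ ε^m Σ_{σ ∈ A, σ|_E = τ|_E} Σ_{X_p = x} ‖W_σ(X)‖` (more known legs, fewer summands).
[cite: BenfattoGiulianiMastropietro2006, §2.8 (2.88)-(2.90)] -/
theorem prescribedSum_antitone {ε : ℝ} (hε : 0 ≤ ε) {m : ℕ} (A : Finset (Fin (m + 1) → S))
    (W : (Fin (m + 1) → S) → (Fin (m + 1) → P) → 𝕜) {E E' : Finset (Fin (m + 1))} (hEE' : E ⊆ E') (τ : Fin (m + 1) → S)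
    (p : Fin (m + 1)) (x : P) :
    ε ^ m * ∑ σ ∈ A.filter (fun σ => ∀ e ∈ E', σ e = τ e), ∑ X ∈ univ.filter (fun X : Fin (m + 1) → P => X p = x), ‖W σ X‖ ≤
      ε ^ m * ∑ σ ∈ A.filter (fun σ => ∀ e ∈ E, σ e = τ e), ∑ X ∈ univ.filter (fun X : Fin (m + 1) → P => X p = x), ‖W σ X‖ := by
  refine mul_le_mul_of_nonneg_left ?_ (pow_nonneg hε _)
  refine sum_le_sum_of_subset_of_nonneg (fun σ hσ => ?_) fun σ _ _ => sum_nonneg fun X _ => norm_nonneg _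
  rw [mem_filter] at hσ ⊢
  exact ⟨hσ.1, fun e he => hσ.2 e (hEE' he)⟩

/-- **One prescribed leg = the anchored leg sum**: for `E = {p}`,
`ε^m Σ_{σ ∈ A, σ_p = τ_p} Σ_{X_p = x} ‖W_σ(X)‖ = legSum_A(W; p, τ_p, x)`. [cite: BenfattoGiulianiMastropietro2006, §2.8 (2.89)] -/
theorem prescribedSum_singleton_eq_sectorLegSum (ε : ℝ) {m : ℕ} (A : Finset (Fin (m + 1) → S))
    (W : (Fin (m + 1) → S) → (Fin (m + 1) → P) → 𝕜) (τ : Fin (m + 1) → S) (p : Fin (m + 1)) (x : P) :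
    ε ^ m * ∑ σ ∈ A.filter (fun σ => ∀ e ∈ ({p} : Finset (Fin (m + 1))), σ e = τ e),
        ∑ X ∈ univ.filter (fun X : Fin (m + 1) → P => X p = x), ‖W σ X‖ = sectorLegSum ε A W p (τ p) x := by
  rw [sectorLegSum, mul_sum]
  refine sum_congr ?_ fun σ _ => rfl
  ext σ
  simp only [mem_filter, mem_singleton, forall_eq]

/-- **Every track is bounded by the anchored leg sum**: for `p ∈ E`,
`ε^m Σ_{σ ∈ A, σ|_E = τ|_E} Σ_{X_p = x} ‖W_σ(X)‖ ≤ legSum_A(W; p, τ_p, x)` (and hence `≤ ‖W‖_A`, `sectorLegSum_le_sectorisedKernelNorm`).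
[cite: BenfattoGiulianiMastropietro2006, §2.8 (2.88)-(2.90)] -/
theorem prescribedSum_le_sectorLegSum {ε : ℝ} (hε : 0 ≤ ε) {m : ℕ} (A : Finset (Fin (m + 1) → S))
    (W : (Fin (m + 1) → S) → (Fin (m + 1) → P) → 𝕜) {E : Finset (Fin (m + 1))} (τ : Fin (m + 1) → S) {p : Fin (m + 1)}
    (hp : p ∈ E) (x : P) :
    ε ^ m * ∑ σ ∈ A.filter (fun σ => ∀ e ∈ E, σ e = τ e), ∑ X ∈ univ.filter (fun X : Fin (m + 1) → P => X p = x), ‖W σ X‖ ≤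
      sectorLegSum ε A W p (τ p) x := by
  rw [← prescribedSum_singleton_eq_sectorLegSum ε A W τ p x]
  exact prescribedSum_antitone hε A W (singleton_subset_iff.2 hp) τ p x

/-- **All legs prescribed = the pinned size of one tuple**: for `E = univ`,
`ε^m Σ_{σ ∈ A, σ = τ} Σ_{X_p = x} ‖W_σ(X)‖ = ε^m Σ_{X_p = x} ‖W_τ(X)‖` if `τ ∈ A`, and `= 0` otherwise.
[cite: BenfattoGiulianiMastropietro2006, §2.8 (2.90)] -/
theorem prescribedSum_univ_eq (ε : ℝ) {m : ℕ} (A : Finset (Fin (m + 1) → S))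
    (W : (Fin (m + 1) → S) → (Fin (m + 1) → P) → 𝕜) (τ : Fin (m + 1) → S) (p : Fin (m + 1)) (x : P) :
    ε ^ m * ∑ σ ∈ A.filter (fun σ => ∀ e ∈ (univ : Finset (Fin (m + 1))), σ e = τ e),
        ∑ X ∈ univ.filter (fun X : Fin (m + 1) → P => X p = x), ‖W σ X‖ =
      if τ ∈ A then ε ^ m * ∑ X ∈ univ.filter (fun X : Fin (m + 1) → P => X p = x), ‖W τ X‖ else 0 := by
  have hfilt : A.filter (fun σ => ∀ e ∈ (univ : Finset (Fin (m + 1))), σ e = τ e) = A.filter (fun σ => σ = τ) := by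
    refine filter_congr fun σ _ => ?_
    simp only [mem_univ, forall_true_left]
    exact ⟨fun h => funext h, fun h e => by rw [h]⟩
  rw [hfilt]
  split_ifs with hτ
  · rw [filter_eq' A τ, if_pos hτ, sum_singleton]
  · rw [filter_eq' A τ, if_neg hτ, sum_empty, mul_zero]

/-- **Count × per-tuple size**: if the pinned sizes of the single tuples of `A` with the prescription are `≤ b` (`ε^m Σ_{X_p = x} ‖W_σ(X)‖ ≤ b`
for every `σ ∈ A` with `σ|_E = τ|_E`), then `ε^m Σ_{σ ∈ A, σ|_E = τ|_E} Σ_{X_p = x} ‖W_σ(X)‖ ≤ #{σ ∈ A : σ|_E = τ|_E} · b` — a sparse class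
of configurations is paid by its cardinality at fixed prescription. [cite: BenfattoGiulianiMastropietro2006, §2.8 (2.89)-(2.90)] -/
theorem prescribedSum_le_card_mul (ε : ℝ) {m : ℕ} (A : Finset (Fin (m + 1) → S))
    (W : (Fin (m + 1) → S) → (Fin (m + 1) → P) → 𝕜) (E : Finset (Fin (m + 1))) (τ : Fin (m + 1) → S) (p : Fin (m + 1)) (x : P)
    {b : ℝ} (hb : ∀ σ ∈ A, (∀ e ∈ E, σ e = τ e) →
      ε ^ m * ∑ X ∈ univ.filter (fun X : Fin (m + 1) → P => X p = x), ‖W σ X‖ ≤ b) :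
    ε ^ m * ∑ σ ∈ A.filter (fun σ => ∀ e ∈ E, σ e = τ e), ∑ X ∈ univ.filter (fun X : Fin (m + 1) → P => X p = x), ‖W σ X‖ ≤
      ((A.filter fun σ => ∀ e ∈ E, σ e = τ e).card : ℝ) * b := by
  rw [mul_sum]
  calc ∑ σ ∈ A.filter (fun σ => ∀ e ∈ E, σ e = τ e), ε ^ m * ∑ X ∈ univ.filter (fun X : Fin (m + 1) → P => X p = x), ‖W σ X‖
      ≤ ∑ _σ ∈ A.filter (fun σ => ∀ e ∈ E, σ e = τ e), b :=
        sum_le_sum fun σ hσ => hb σ (mem_filter.1 hσ).1 (mem_filter.1 hσ).2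
    _ = _ := by rw [sum_const, nsmul_eq_mul]

/-- **Count × per-tuple size, uniform form**: with `K` bounding `#{σ ∈ A : σ|_E = τ|_E}` and `b ≥ 0` bounding the per-tuple pinned sizes on `A`,
the prescribed sum is `≤ K · b`. [cite: BenfattoGiulianiMastropietro2006, §2.8 (2.89)-(2.90)] -/
theorem prescribedSum_le_of_card_le (ε : ℝ) {m : ℕ} (A : Finset (Fin (m + 1) → S))
    (W : (Fin (m + 1) → S) → (Fin (m + 1) → P) → 𝕜) (E : Finset (Fin (m + 1))) (τ : Fin (m + 1) → S) (p : Fin (m + 1)) (x : P)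
    {K b : ℝ} (hb0 : 0 ≤ b) (hK : ((A.filter fun σ => ∀ e ∈ E, σ e = τ e).card : ℝ) ≤ K)
    (hb : ∀ σ ∈ A, ε ^ m * ∑ X ∈ univ.filter (fun X : Fin (m + 1) → P => X p = x), ‖W σ X‖ ≤ b) :
    ε ^ m * ∑ σ ∈ A.filter (fun σ => ∀ e ∈ E, σ e = τ e), ∑ X ∈ univ.filter (fun X : Fin (m + 1) → P => X p = x), ‖W σ X‖ ≤
      K * b :=
  (prescribedSum_le_card_mul ε A W E τ p x fun σ hσ _ => hb σ hσ).trans (mul_le_mul_of_nonneg_right hK hb0)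

/-- **Subadditivity in the kernel family**: the prescribed sum of `W + W′` is at most the sum of those of `W` and `W′` (the effective
potential is the sum of its tree values, (2.75)/(2.83), each estimated separately). [cite: BenfattoGiulianiMastropietro2006, §2.8 (2.75) and (2.83)] -/
theorem prescribedSum_add_le {ε : ℝ} (hε : 0 ≤ ε) {m : ℕ} (A : Finset (Fin (m + 1) → S))
    (W W' : (Fin (m + 1) → S) → (Fin (m + 1) → P) → 𝕜) (E : Finset (Fin (m + 1))) (τ : Fin (m + 1) → S) (p : Fin (m + 1)) (x : P) :
    ε ^ m * ∑ σ ∈ A.filter (fun σ => ∀ e ∈ E, σ e = τ e), ∑ X ∈ univ.filter (fun X : Fin (m + 1) → P => X p = x), ‖(W + W') σ X‖ ≤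
      ε ^ m * ∑ σ ∈ A.filter (fun σ => ∀ e ∈ E, σ e = τ e), ∑ X ∈ univ.filter (fun X : Fin (m + 1) → P => X p = x), ‖W σ X‖ +
        ε ^ m * ∑ σ ∈ A.filter (fun σ => ∀ e ∈ E, σ e = τ e), ∑ X ∈ univ.filter (fun X : Fin (m + 1) → P => X p = x), ‖W' σ X‖ := by
  rw [← mul_add, ← sum_add_distrib]
  refine mul_le_mul_of_nonneg_left (sum_le_sum fun σ _ => ?_) (pow_nonneg hε _)
  rw [← sum_add_distrib]
  exact sum_le_sum fun X _ => norm_add_le _ _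

/-- **Subadditivity over a finite sum of kernel families** (an effective action is the sum of its increments, each re-measured separately):
the prescribed sum of `Σ_{j ∈ J} W_j` is at most `Σ_{j ∈ J}` (prescribed sum of `W_j`). [cite: BenfattoGiulianiMastropietro2006, §2.8 (2.75) and (2.83)] -/
theorem prescribedSum_sum_le {ε : ℝ} (hε : 0 ≤ ε) {m : ℕ} (A : Finset (Fin (m + 1) → S)) {ι : Type*} (J : Finset ι)
    (W : ι → (Fin (m + 1) → S) → (Fin (m + 1) → P) → 𝕜) (E : Finset (Fin (m + 1))) (τ : Fin (m + 1) → S) (p : Fin (m + 1)) (x : P) :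
    ε ^ m * ∑ σ ∈ A.filter (fun σ => ∀ e ∈ E, σ e = τ e), ∑ X ∈ univ.filter (fun X : Fin (m + 1) → P => X p = x), ‖(∑ j ∈ J, W j) σ X‖ ≤
      ∑ j ∈ J, ε ^ m * ∑ σ ∈ A.filter (fun σ => ∀ e ∈ E, σ e = τ e),
        ∑ X ∈ univ.filter (fun X : Fin (m + 1) → P => X p = x), ‖W j σ X‖ := by
  classical
  induction J using Finset.induction_on with
  | empty => simp
  | insert j J hj ih =>
    rw [sum_insert hj, sum_insert hj]
    exact (prescribedSum_add_le hε A (W j) (∑ i ∈ J, W i) E τ p x).trans (by gcongr)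

/-! ### The Hubbard forms -/

section Hubbard

variable {L M : ℕ} [NeZero L] {N : ℕ}

/-- Sectorised kernels are additive in `G` over a finite sum ((2.70) is linear in the potential). [cite: BenfattoGiulianiMastropietro2006, §2.7 (2.70)] -/
theorem sectorisedKernel_sum (β : ℝ) (F : Fin N → FreqMomentum L M → ℂ) {ι : Type*} (J : Finset ι) (G : ι → HubbardGrassmann L M)
    (m : ℕ) : sectorisedKernel L M β F (∑ j ∈ J, G j) m = ∑ j ∈ J, sectorisedKernel L M β F (G j) m := by
  classical
  induction J using Finset.induction_on with
  | empty =>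
    rw [sum_empty, sum_empty]
    funext Ω x
    simp [sectorisedKernel]
  | insert j J hj ih => rw [sum_insert hj, sum_insert hj, sectorisedKernel_add, ih]

/-- **Re-measuring a sum of increments**: the prescribed sums of the sector kernels of `Σ_{j ∈ J} G_j` in any family `F` are at most the sums over
`j` of those of the `G_j`. [cite: BenfattoGiulianiMastropietro2006, §2.8 (2.75) and (2.83)] -/
theorem hubbardSectorPrescribedSum_sum_le {β : ℝ} (hβ : 0 ≤ β) (F : Fin N → FreqMomentum L M → ℂ) {ι : Type*} (J : Finset ι)
    (G : ι → HubbardGrassmann L M) (m : ℕ) (A : Finset (Fin (m + 1) → SectorLeg N)) (E : Finset (Fin (m + 1)))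
    (τ : Fin (m + 1) → SectorLeg N) (p : Fin (m + 1)) (x : SpaceTimeIdx L M) :
    imagTimeWeight β M ^ m * ∑ σ ∈ A.filter (fun σ => ∀ e ∈ E, σ e = τ e),
        ∑ X ∈ univ.filter (fun X : Fin (m + 1) → SpaceTimeIdx L M => X p = x), ‖sectorisedKernel L M β F (∑ j ∈ J, G j) (m + 1) σ X‖ ≤
      ∑ j ∈ J, imagTimeWeight β M ^ m * ∑ σ ∈ A.filter (fun σ => ∀ e ∈ E, σ e = τ e),
        ∑ X ∈ univ.filter (fun X : Fin (m + 1) → SpaceTimeIdx L M => X p = x), ‖sectorisedKernel L M β F (G j) (m + 1) σ X‖ := by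
  rw [sectorisedKernel_sum]
  exact prescribedSum_sum_le (imagTimeWeight_nonneg hβ M) A J (fun j => sectorisedKernel L M β F (G j) (m + 1)) E τ p x

end Hubbard

end Literature.MathematicalPhysics.QuantumLattice

end
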